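import Summits.KontsevichZagierPeriods.Zeta5Search.SymRayBasics
import Summits.KontsevichZagierPeriods.Zeta5Search.WedgeDictionaryConsequences
import HarnessLib

/-!
# The diagonal shift of the wedge dictionary (D2 lane, relation (DS))

HONEST FRAMING: systematic search; no irrationality claim unless certified.

For a box shape `b = (b₀; b₁, …, b₇)` of the dual Brown–Zudilin series write
`b⁺ = dsShift b = (b₀ + 2; b₁ + 1, …, b₇ + 1)` (the *diagonal shift*) and, for `1 ≤ i ≤ 7`,
`λ_i(b) = (b_i + 1)(b₀ − b_i + 1)` (`dsLam`).  We prove, for each of the three canonical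
coefficients `X ∈ {U, W, V}` of `WedgeDictionary` (`coeffU`, `coeffW`, `coeffV`) and every
admissible direction `i`,

  `X(b⁺) = X(b + e_i) − λ_i(b) · X(b)`                                   (DS)

(`coeffU_dsShift`, `coeffW_dsShift`, `coeffV_dsShift`).  In particular the right-hand side
does not depend on `i`, which re-proves the first family of four-term relations.

Proof.  On the level of the summands `R_b(t) = numPoly_b(t+1)/(t+1)_{b₀+1}^6` one has the two
rational-function identities
* `R_{b+e_i}(t) − λ_i R_b(t) = t (t + b₀ + 2) R_b(t)` (`pfEval_dsDiff`, from `numPoly_update`), and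
* `R_{b⁺}(t) = (t+1)(t+b₀+3) R_b(t+1)` (`pfEval_dsShift`, from `eval_numPoly_dsShift`:
  `numPoly_{b⁺}(x) = (x (x+b₀+2))⁷ · numPoly_b(x+1)`),
so `R_{b⁺}(t) = G(t+1)` with `G = R_{b+e_i} − λ_i R_b`.  By uniqueness of partial fractions
(`BallRivoal.pf_unique`) the data of `b⁺` are the shifted data of `G` (`ds_data_eq`); the
coefficient sums are shift invariant (`sum_shiftUp`) and the constant-term functional changes by
`G(0) = 0` (`Vfun_shiftUp`).  Everything is over `ℚ`; no series, no analysis.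

This is the relation (DS) of the D2 frame calculus (memo `pub-zeta5-gen-1/D2-FRAME-g14.md`):
together with the ray contiguity relations it expresses every dual point near the diagonal in
the ray frame.
-/

open Finset Polynomial

namespace Summit.KontsevichZagierPeriods.Zeta5Search.WedgeDictionary

open Summit.KontsevichZagierPeriods.Zeta5Search.DualSeries
open Summit.KontsevichZagierPeriods.Zeta5Search.SymRay
open Literature.NumberTheory.Transcendental
open Literature.NumberTheory.Transcendental.BallRivoal (pfEval pf_unique harm pfEval_sub' pfEval_const_mul)

/-! ### The shift and its bookkeeping -/

/-- The diagonal shift `b⁺ = (b₀ + 2; b₁ + 1, …, b₇ + 1)`. -/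
def dsShift (b : ℕ → ℤ) : ℕ → ℤ := fun j => if j = 0 then b 0 + 2 else b j + 1

/-- `λ_i(b) = (b_i + 1)(b₀ − b_i + 1)` (indexed so that `dsLam b i` belongs to the slot `i + 1`). -/
def dsLam (b : ℕ → ℤ) (i : ℕ) : ℚ := ((b (i + 1) : ℚ) + 1) * ((b 0 : ℚ) - (b (i + 1) : ℚ) + 1)

/-- The data of `G = R_{b+e_{i+1}} − λ R_b`. -/
noncomputable def dsDiff (b : ℕ → ℤ) (i : ℕ) : ℕ → ℕ → ℚ := fun o p =>
  pfData (Function.update b (i + 1) (b (i + 1) + 1)) o p - dsLam b i * pfData b o p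

/-- The leading entry of the shift: `b⁺₀ = b₀ + 2`. -/
@[simp] theorem dsShift_zero (b : ℕ → ℤ) : dsShift b 0 = b 0 + 2 := by simp [dsShift]

/-- The other entries of the shift: `b⁺_j = b_j + 1`. -/
@[simp] theorem dsShift_succ (b : ℕ → ℤ) (j : ℕ) : dsShift b (j + 1) = b (j + 1) + 1 := by
  simp [dsShift]

/-- `b⁺₀` as a natural number. -/
theorem toNat_dsShift_zero {b : ℕ → ℤ} (hb : InBox b) : (dsShift b 0).toNat = (b 0).toNat + 2 := by
  rw [dsShift_zero]; have := hb.1; omega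

/-- The shift of an in-box shape is in the box. -/
theorem inBox_dsShift {b : ℕ → ℤ} (hb : InBox b) : InBox (dsShift b) := by
  refine ⟨by rw [dsShift_zero]; have := hb.1; omega, fun j hj => ?_⟩
  rw [dsShift_succ, dsShift_zero]
  have := hb.2 j hj
  omega

/-- The slot sum grows by `7` under the shift. -/
theorem sum_dsShift (b : ℕ → ℤ) : ∑ j ∈ range 7, dsShift b (j + 1) = ∑ j ∈ range 7, b (j + 1) + 7 := by
  simp only [dsShift_succ, sum_add_distrib, sum_const, card_range]
  rfl

/-- The shifted shape has admissible total degree as soon as `d(b) ≥ 0`. -/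
theorem sum_dsShift_le {b : ℕ → ℤ} (hd : 0 ≤ dOf b) :
    ∑ j ∈ range 7, dsShift b (j + 1) ≤ 3 * dsShift b 0 + 1 := by
  rw [sum_dsShift, dsShift_zero]
  unfold dOf at hd
  omega

/-! ### The numerator polynomial under the shift -/

/-- `numPoly_{b⁺}(x) = (x (x + b₀ + 2))⁷ · numPoly_b(x + 1)`. -/
theorem eval_numPoly_dsShift (b : ℕ → ℤ) (hb : InBox b) (x : ℚ) :
    (numPoly (dsShift b)).eval x = (x * (x + b 0 + 2)) ^ 7 * (numPoly b).eval (x + 1) := by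
  rw [eval_numPoly, eval_numPoly]
  have h : ∀ j ∈ range 7,
      BallRivoal.poch x (dsShift b (j + 1)).toNat *
          BallRivoal.poch (x + ((dsShift b 0 - dsShift b (j + 1) + 1 : ℤ) : ℚ)) (dsShift b (j + 1)).toNat =
        (x * (x + b 0 + 2)) *
          (BallRivoal.poch (x + 1) (b (j + 1)).toNat *
            BallRivoal.poch (x + 1 + ((b 0 - b (j + 1) + 1 : ℤ) : ℚ)) (b (j + 1)).toNat) := by
    intro j hj
    have hbj : 0 ≤ b (j + 1) := (hb.2 j hj).1
    have hn : (dsShift b (j + 1)).toNat = (b (j + 1)).toNat + 1 := by rw [dsShift_succ]; omega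
    have hcast : (((b (j + 1)).toNat : ℕ) : ℚ) = (b (j + 1) : ℚ) := by exact_mod_cast Int.toNat_of_nonneg hbj
    have harg : x + ((dsShift b 0 - dsShift b (j + 1) + 1 : ℤ) : ℚ) = x + 1 + ((b 0 - b (j + 1) + 1 : ℤ) : ℚ) := by
      rw [dsShift_zero, dsShift_succ]; push_cast; ring
    rw [hn, poch_succ_left, poch_succ_right, harg, hcast]
    push_cast
    ring
  rw [prod_congr rfl h, prod_mul_distrib, prod_const, card_range, dsShift_zero]
  push_cast
  ring

/-! ### The two rational-function identities -/

/-- The chosen data evaluate to `R_b` (for an in-box shape of admissible total degree). -/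
theorem pfEval_pfData_eq (b : ℕ → ℤ) (hb : InBox b) (hsum : ∑ j ∈ range 7, b (j + 1) ≤ 3 * b 0 + 1) (t : ℚ)
    (ht : ∀ p, p ≤ (b 0).toNat → t + p + 1 ≠ 0) :
    pfEval (b 0).toNat 6 (pfData b) t =
      ((numPoly b).comp (X + C 1)).eval t / BallRivoal.poch (t + 1) ((b 0).toNat + 1) ^ 6 := by
  obtain ⟨c, hc⟩ := exists_isPFData b hb hsum
  exact isPFData_pfData hc t ht

/-- Linearity: `pfEval` of `dsDiff`. -/
theorem pfEval_dsDiff_lin (b : ℕ → ℤ) (i N K : ℕ) (t : ℚ) :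
    pfEval N K (dsDiff b i) t =
      pfEval N K (pfData (Function.update b (i + 1) (b (i + 1) + 1))) t - dsLam b i * pfEval N K (pfData b) t := by
  unfold dsDiff pfEval
  simp only [sub_div, mul_div_assoc, sum_sub_distrib, mul_sum]

/-- **First identity.** `R_{b+e_i}(t) − λ_i R_b(t) = t (t + b₀ + 2) R_b(t)` (off the poles). -/
theorem pfEval_dsDiff (b : ℕ → ℤ) (hb : InBox b) (hd : 0 ≤ dOf b) {i : ℕ} (hi : i ∈ range 7)
    (hle : b (i + 1) ≤ b 0) (t : ℚ) (ht : ∀ p, p ≤ (b 0).toNat → t + p + 1 ≠ 0) :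
    pfEval (b 0).toNat 6 (dsDiff b i) t = t * (t + (b 0).toNat + 2) * pfEval (b 0).toNat 6 (pfData b) t := by
  have hbox := box_update b hb hd hi hle
  have h0 : Function.update b (i + 1) (b (i + 1) + 1) 0 = b 0 := Function.update_of_ne (by omega) _ _
  have hbi : 0 ≤ b (i + 1) := (hb.2 i hi).1
  have hN : (((b 0).toNat : ℕ) : ℚ) = (b 0 : ℚ) := by exact_mod_cast Int.toNat_of_nonneg hb.1
  have F1 := pfEval_pfData_eq _ hbox.1 hbox.2 t (by rw [h0]; exact ht)
  rw [h0] at F1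
  rw [pfEval_dsDiff_lin, F1, pfEval_pfData_eq b hb (sum_le_of_dOf b hd) t ht, numPoly_update b hi hbi]
  simp only [mul_comp, add_comp, X_comp, C_comp, eval_mul, eval_add, eval_X, eval_C]
  unfold dsLam
  push_cast
  rw [hN]
  ring

/-- Pochhammer bookkeeping: `(s)_{N+3} = s (s+1)_{N+1} (s + 1 + (N+1))`. -/
theorem poch_add_three (s : ℚ) (N : ℕ) :
    BallRivoal.poch s (N + 2 + 1) = s * (BallRivoal.poch (s + 1) (N + 1) * (s + 1 + ((N + 1 : ℕ) : ℚ))) := by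
  rw [poch_succ_left, show N + 2 = N + 1 + 1 from rfl, poch_succ_right]

/-- The rational-function algebra behind `pfEval_dsShift`. -/
private theorem ds_alg (t n A P : ℚ) (h1 : t + 1 ≠ 0) (h2 : t + n + 3 ≠ 0) :
    ((t + 1) * (t + 1 + n + 2)) ^ 7 * A / ((t + 1) * (P * (t + 1 + 1 + (n + 1)))) ^ 6 =
      (t + 1) * (t + n + 3) * (A / P ^ 6) := by
  have hu : (t + 1) * (t + n + 3) ≠ 0 := mul_ne_zero h1 h2
  have e1 : ((t + 1) * (t + 1 + n + 2)) ^ 7 * A = ((t + 1) * (t + n + 3)) ^ 6 * (((t + 1) * (t + n + 3)) * A) := by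
    ring
  have e2 : ((t + 1) * (P * (t + 1 + 1 + (n + 1)))) ^ 6 = ((t + 1) * (t + n + 3)) ^ 6 * P ^ 6 := by ring
  rw [e1, e2, mul_div_mul_left _ _ (pow_ne_zero 6 hu)]
  ring

/-- **Second identity.** `R_{b⁺}(t) = (t+1)(t+b₀+3) · R_b(t+1)` (off the poles). -/
theorem pfEval_dsShift (b : ℕ → ℤ) (hb : InBox b) (hd : 0 ≤ dOf b) (t : ℚ)
    (ht : ∀ p, p ≤ (b 0).toNat + 2 → t + p + 1 ≠ 0) :
    pfEval ((b 0).toNat + 2) 6 (pfData (dsShift b)) t =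
      (t + 1) * (t + (b 0).toNat + 3) * pfEval (b 0).toNat 6 (pfData b) (t + 1) := by
  have hN2 := toNat_dsShift_zero hb
  have hN : (((b 0).toNat : ℕ) : ℚ) = (b 0 : ℚ) := by exact_mod_cast Int.toNat_of_nonneg hb.1
  have F := pfEval_pfData_eq (dsShift b) (inBox_dsShift hb) (sum_dsShift_le hd) t (by rw [hN2]; exact ht)
  rw [hN2] at F
  have ht' : ∀ p, p ≤ (b 0).toNat → t + 1 + p + 1 ≠ 0 := fun p hp h => by
    have := ht (p + 1) (by omega)
    push_cast at this
    exact this (by linarith)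
  rw [F, pfEval_pfData_eq b hb (sum_le_of_dOf b hd) (t + 1) ht']
  simp only [eval_comp, eval_add, eval_X, eval_C]
  rw [eval_numPoly_dsShift b hb, poch_add_three, ← hN]
  push_cast
  have h1 : t + 1 ≠ 0 := by have := ht 0 (by omega); simpa using this
  have h2 : t + ((b 0).toNat : ℚ) + 3 ≠ 0 := fun h => by
    have := ht ((b 0).toNat + 2) le_rfl
    push_cast at this
    exact this (by linarith)
  exact ds_alg t _ _ _ h1 h2

/-! ### The data identity and (DS) -/

/-- **The data of `b⁺` are the shifted data of `G = R_{b+e_i} − λ_i R_b`.** -/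
theorem ds_data_eq (b : ℕ → ℤ) (hb : InBox b) (hd : 0 ≤ dOf b) {i : ℕ} (hi : i ∈ range 7)
    (hle : b (i + 1) ≤ b 0) {o p : ℕ} (ho : o < 6) (hp : p ≤ (b 0).toNat + 2) :
    pfData (dsShift b) o p = padData ((b 0).toNat + 1) (shiftUp (dsDiff b i)) o p := by
  refine sub_eq_zero.1 (data_eq_zero_of_pfEval_zero ((b 0).toNat + 2) 6
    (fun o p => pfData (dsShift b) o p - padData ((b 0).toNat + 1) (shiftUp (dsDiff b i)) o p) (fun t => ?_) ho hp)
  rw [pfEval_sub', pfEval_padData (by omega), pfEval_shiftUp,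
    pfEval_dsShift b hb hd t (fun p _ => by positivity),
    pfEval_dsDiff b hb hd hi hle ((t : ℚ) + 1) (fun p _ => by positivity)]
  ring

/-- Coefficient sums of `dsDiff`. -/
theorem sum_dsDiff (b : ℕ → ℤ) (i N o : ℕ) :
    ∑ p ∈ range (N + 1), dsDiff b i o p =
      ∑ p ∈ range (N + 1), pfData (Function.update b (i + 1) (b (i + 1) + 1)) o p -
        dsLam b i * ∑ p ∈ range (N + 1), pfData b o p := by
  unfold dsDiff
  rw [sum_sub_distrib, mul_sum]

/-- `Vfun` of `dsDiff`. -/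
theorem Vfun_dsDiff (b : ℕ → ℤ) (i N K : ℕ) :
    Vfun N K (dsDiff b i) =
      Vfun N K (pfData (Function.update b (i + 1) (b (i + 1) + 1))) - dsLam b i * Vfun N K (pfData b) := by
  unfold Vfun dsDiff
  simp only [sub_mul, mul_assoc, sum_sub_distrib, mul_sum]

/-- The order-`o` coefficient sum under the diagonal shift. -/
theorem sum_pfData_dsShift (b : ℕ → ℤ) (hb : InBox b) (hd : 0 ≤ dOf b) {i : ℕ} (hi : i ∈ range 7)
    (hle : b (i + 1) ≤ b 0) {o : ℕ} (ho : o < 6) :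
    ∑ p ∈ range ((dsShift b 0).toNat + 1), pfData (dsShift b) o p =
      ∑ p ∈ range ((b 0).toNat + 1), pfData (Function.update b (i + 1) (b (i + 1) + 1)) o p -
        dsLam b i * ∑ p ∈ range ((b 0).toNat + 1), pfData b o p := by
  rw [toNat_dsShift_zero hb,
    sum_congr rfl fun p hp => ds_data_eq b hb hd hi hle ho (Nat.lt_succ_iff.1 (mem_range.1 hp)),
    sum_padData (by omega)]
  have hs := sum_shiftUp (b 0).toNat (dsDiff b i) o
  rw [show (b 0).toNat + 2 = (b 0).toNat + 1 + 1 from rfl] at hs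
  rw [hs, sum_dsDiff]

/-- **(DS) for `U`.**  `U(b⁺) = U(b + e_{i+1}) − λ · U(b)` for every admissible direction. -/
theorem coeffU_dsShift (b : ℕ → ℤ) (hb : InBox b) (hd : 0 ≤ dOf b) {i : ℕ} (hi : i ∈ range 7)
    (hle : b (i + 1) ≤ b 0) :
    coeffU (dsShift b) = coeffU (Function.update b (i + 1) (b (i + 1) + 1)) - dsLam b i * coeffU b := by
  have h0 : Function.update b (i + 1) (b (i + 1) + 1) 0 = b 0 := Function.update_of_ne (by omega) _ _
  unfold coeffU
  rw [h0, sum_pfData_dsShift b hb hd hi hle (by norm_num)]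

/-- **(DS) for `W`.** -/
theorem coeffW_dsShift (b : ℕ → ℤ) (hb : InBox b) (hd : 0 ≤ dOf b) {i : ℕ} (hi : i ∈ range 7)
    (hle : b (i + 1) ≤ b 0) :
    coeffW (dsShift b) = coeffW (Function.update b (i + 1) (b (i + 1) + 1)) - dsLam b i * coeffW b := by
  have h0 : Function.update b (i + 1) (b (i + 1) + 1) 0 = b 0 := Function.update_of_ne (by omega) _ _
  unfold coeffW
  rw [h0, sum_pfData_dsShift b hb hd hi hle (by norm_num)]

/-- `coeffV` is the constant-term functional of the chosen data. -/
theorem coeffV_eq_Vfun (b : ℕ → ℤ) : coeffV b = Vfun (b 0).toNat 6 (pfData b) := rfl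

/-- **(DS) for `V`.**  Here the shift contributes `G(0) = 0`. -/
theorem coeffV_dsShift (b : ℕ → ℤ) (hb : InBox b) (hd : 0 ≤ dOf b) {i : ℕ} (hi : i ∈ range 7)
    (hle : b (i + 1) ≤ b 0) :
    coeffV (dsShift b) = coeffV (Function.update b (i + 1) (b (i + 1) + 1)) - dsLam b i * coeffV b := by
  have h0 : Function.update b (i + 1) (b (i + 1) + 1) 0 = b 0 := Function.update_of_ne (by omega) _ _
  rw [coeffV_eq_Vfun, coeffV_eq_Vfun, coeffV_eq_Vfun, h0, toNat_dsShift_zero hb]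
  have hE : Vfun ((b 0).toNat + 2) 6 (pfData (dsShift b)) =
      Vfun ((b 0).toNat + 2) 6 (padData ((b 0).toNat + 1) (shiftUp (dsDiff b i))) := by
    unfold Vfun
    exact sum_congr rfl fun o ho => sum_congr rfl fun p hp => by
      rw [ds_data_eq b hb hd hi hle (mem_range.1 ho) (Nat.lt_succ_iff.1 (mem_range.1 hp))]
  rw [hE, Vfun_padData (by omega), Vfun_shiftUp, Vfun_dsDiff,
    pfEval_dsDiff b hb hd hi hle 0 (fun p _ => by positivity)]
  ring

/-- (DS) packaged: the three coefficients at once. -/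
theorem dictionary_dsShift (b : ℕ → ℤ) (hb : InBox b) (hd : 0 ≤ dOf b) {i : ℕ} (hi : i ∈ range 7)
    (hle : b (i + 1) ≤ b 0) :
    coeffU (dsShift b) = coeffU (Function.update b (i + 1) (b (i + 1) + 1)) - dsLam b i * coeffU b ∧
    coeffW (dsShift b) = coeffW (Function.update b (i + 1) (b (i + 1) + 1)) - dsLam b i * coeffW b ∧
    coeffV (dsShift b) = coeffV (Function.update b (i + 1) (b (i + 1) + 1)) - dsLam b i * coeffV b :=
  ⟨coeffU_dsShift b hb hd hi hle, coeffW_dsShift b hb hd hi hle, coeffV_dsShift b hb hd hi hle⟩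


end Summit.KontsevichZagierPeriods.Zeta5Search.WedgeDictionary
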